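import Mathlib.Analysis.SpecialFunctions.Sqrt
import Mathlib.LinearAlgebra.Matrix.NonsingularInverse
import Mathlib.LinearAlgebra.Matrix.Trace
import Literature.Analysis.Calculus.JacobianNullLagrangian
import HarnessLib

/-!
# Jacobi's formula and the derivative of the inverse for matrix-valued fields

Topic `Literature/Analysis/Calculus`. For a differentiable field of square matrices
`A : E → (ι → ι → ℝ)` on a real normed space `E` (Fréchet derivative `A'` at `y`) we prove the
two classical differentiation rules of matrix calculus (Magnus–Neudecker, *Matrix Differential
Calculus*, 3rd ed. 2019, Ch. 8, Thm. 8.1 `d|X| = tr(X# dX)` (Jacobi's formula) and Thm. 8.3 /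
§8.4 `dX⁻¹ = -X⁻¹ (dX) X⁻¹`; Horn–Johnson, *Matrix Analysis*, 2nd ed., §0.8.10):

* `det_updateRow_eq_sum_mul_adjugate` — Laplace expansion along a replaced row,
  `det (M with row j := w) = ∑ᵢ wᵢ adj(M)ᵢⱼ`;
* `hasFDerivAt_det` — **Jacobi's formula**: `z ↦ det A(z)` is differentiable at `y` with
  derivative `v ↦ ∑ⱼ ∑ᵢ adj(A y)ᵢⱼ (A' v)ⱼᵢ = tr (A' v · adj (A y))`
  (`hasFDerivAt_det_apply_eq_trace`), which is `det A(y) · tr (A(y)⁻¹ A' v)` when `A y` is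
  invertible (`hasFDerivAt_det_apply_eq_det_mul_trace`);
* `hasFDerivAt_sqrt_det`, `hasFDerivAt_sqrt_det_apply` — for `det A(y) > 0`,
  `d√(det A) (v) = ½ √(det A(y)) · tr (A(y)⁻¹ A' v)` (the form in which Jacobi's formula enters
  the Riemannian volume density `√(det g_{ij})`: `∂ᵢ log √g = ½ gᵃᵇ ∂ᵢ g_{ab}`);
* `hasFDerivAt_inv_apply` — **derivative of the inverse**: if `det A(y) ≠ 0`, every entry of
  `z ↦ A(z)⁻¹` is differentiable at `y` and `d(A⁻¹)ₖₗ (v) = -∑ᵢⱼ (A⁻¹)ₖᵢ (A' v)ᵢⱼ (A⁻¹)ⱼₗ`.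

Matrices are handled as `ι → ι → ℝ` (rows), which carries the product (sup) norm, and read as
`Matrix ι ι ℝ` through `Matrix.of` for `det`, `adjugate`, `⁻¹`, `trace`; the determinant as a
continuous multilinear map of the rows is the tree's `detRowsCLM` (`JacobianNullLagrangian.lean`),
whose derivative is Mathlib's `ContinuousMultilinearMap.hasFDerivAt`. The derivative of the
inverse is obtained by implicit differentiation of `A · A⁻¹ = 1` near `y` (entries of `A⁻¹` are
differentiable by `A⁻¹ = (det A)⁻¹ adj A` and Jacobi's formula for the cofactors).

Mathlib has `Matrix.det_one_add_smul` (derivative of `det` at `1`) and `hasFDerivAt_ringInverse`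
(in a complete normed ring, for a norm not available on `Matrix` by default) but neither rule in
the above form; the tree has curve versions of Jacobi's formula in dimensions `2` and `3`
(`LiouvilleDeterminant.lean`, `InverseFlowDivergence.lean`) and the general row expansion
`hasDerivAt_det_rows`.

## References

* J. R. Magnus, H. Neudecker, *Matrix Differential Calculus with Applications in Statistics and
  Econometrics*, 3rd ed., Wiley 2019, Ch. 8, Thm. 8.1 and §8.4.
* R. A. Horn, C. R. Johnson, *Matrix Analysis*, 2nd ed., CUP 2013, §0.8.10 (Jacobi's formula).
-/

noncomputable section

open Matrix Function Finset Filter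
open scoped Topology

namespace Literature.Analysis.Calculus

variable {ι : Type*} [Fintype ι] [DecidableEq ι]

/-! ### Laplace expansion along a replaced row -/

/-- **Laplace expansion along a replaced row**: `det (M.updateRow j w) = ∑ᵢ wᵢ · adj(M)ᵢⱼ`
(`adj(M)ᵢⱼ = det (M.updateRow j eᵢ)`, linearity of `det` in row `j`). [folklore] -/
theorem det_updateRow_eq_sum_mul_adjugate (M : Matrix ι ι ℝ) (j : ι) (w : ι → ℝ) :
    (M.updateRow j w).det = ∑ i, w i * M.adjugate i j := by
  rw [det_eq_sum_mul_adjugate_row _ j]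
  refine sum_congr rfl (fun i _ ↦ ?_)
  rw [updateRow_self, adjugate_apply, updateRow_idem, ← adjugate_apply]

/-- The double sum `∑ⱼ ∑ᵢ adj(M)ᵢⱼ Wⱼᵢ` is the trace `tr (W · adj M)`. [folklore] -/
theorem sum_sum_adjugate_mul_eq_trace (M W : Matrix ι ι ℝ) :
    ∑ j, ∑ i, M.adjugate i j * W j i = (W * M.adjugate).trace := by
  simp only [Matrix.trace, Matrix.diag, Matrix.mul_apply]
  refine sum_congr rfl (fun j _ ↦ sum_congr rfl (fun i _ ↦ mul_comm _ _))

/-- For an invertible matrix, `adj M = det M • M⁻¹`. [folklore] -/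
theorem adjugate_eq_det_smul_inv (M : Matrix ι ι ℝ) (hM : IsUnit M.det) :
    M.adjugate = M.det • M⁻¹ := by
  rw [Matrix.inv_def, smul_smul, Ring.mul_inverse_cancel _ hM, one_smul]

/-- For an invertible matrix, `tr (W · adj M) = det M · tr (M⁻¹ W)`. [folklore] -/
theorem trace_mul_adjugate_eq_det_mul_trace (M W : Matrix ι ι ℝ) (hM : IsUnit M.det) :
    (W * M.adjugate).trace = M.det * (M⁻¹ * W).trace := by
  rw [adjugate_eq_det_smul_inv M hM, Matrix.mul_smul, Matrix.trace_smul, smul_eq_mul,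
    Matrix.trace_mul_comm]

/-! ### Jacobi's formula -/

variable {E : Type*} [NormedAddCommGroup E] [NormedSpace ℝ E]
  {A : E → ι → ι → ℝ} {A' : E →L[ℝ] ι → ι → ℝ} {y : E}

/-- **Jacobi's formula** (Fréchet form). If the matrix field `A` (rows `A z j`) has derivative
`A'` at `y`, then `z ↦ det A(z)` has derivative `v ↦ ∑ⱼ ∑ᵢ adj(A y)ᵢⱼ · (A' v)ⱼᵢ` at `y`
(the determinant is multilinear in the rows, and `det (A with row j := w) = ∑ᵢ wᵢ adjᵢⱼ`).
Magnus–Neudecker 2019, Ch. 8, Thm. 8.1; Horn–Johnson 2013, §0.8.10. [cite: MagnusNeudecker2019, Ch. 8 Thm. 8.1] -/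
theorem hasFDerivAt_det (hA : HasFDerivAt A A' y) :
    HasFDerivAt (fun z ↦ (Matrix.of (A z)).det)
      (∑ j, ∑ i, (Matrix.of (A y)).adjugate i j •
        ((ContinuousLinearMap.proj i).comp ((ContinuousLinearMap.proj j).comp A'))) y := by
  have h : HasFDerivAt (fun z ↦ (Matrix.of (A z)).det)
      (((detRowsCLM ι).linearDeriv (A y)).comp A') y :=
    ((detRowsCLM ι).hasFDerivAt (A y)).comp y hA
  refine h.congr_fderiv ?_
  ext v
  simp only [ContinuousLinearMap.comp_apply, ContinuousMultilinearMap.linearDeriv_apply,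
    detRowsCLM_apply, FunLike.coe_sum, Finset.sum_apply,
    _root_.smul_apply, ContinuousLinearMap.proj_apply, smul_eq_mul]
  refine sum_congr rfl (fun j _ ↦ ?_)
  rw [show Matrix.of (update (A y) j (A' v j)) = (Matrix.of (A y)).updateRow j (A' v j) from rfl,
    det_updateRow_eq_sum_mul_adjugate]
  exact sum_congr rfl (fun i _ ↦ mul_comm _ _)

/-- Jacobi's formula, trace form: the derivative of `det A` at `y` applied to `v` is
`tr (A' v · adj (A y))`. [cite: MagnusNeudecker2019, Ch. 8 Thm. 8.1] -/
theorem hasFDerivAt_det_apply_eq_trace (v : E) :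
    (∑ j, ∑ i, (Matrix.of (A y)).adjugate i j •
        ((ContinuousLinearMap.proj i).comp ((ContinuousLinearMap.proj j).comp A'))) v =
      (Matrix.of (A' v) * (Matrix.of (A y)).adjugate).trace := by
  simp only [FunLike.coe_sum, Finset.sum_apply, _root_.smul_apply,
    ContinuousLinearMap.comp_apply, ContinuousLinearMap.proj_apply, smul_eq_mul]
  rw [← sum_sum_adjugate_mul_eq_trace]
  rfl

/-- Jacobi's formula for an invertible matrix: the derivative of `det A` at `y` applied to `v`
is `det A(y) · tr (A(y)⁻¹ · A' v)`. Magnus–Neudecker 2019, Ch. 8, Thm. 8.1 (second form).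
[cite: MagnusNeudecker2019, Ch. 8 Thm. 8.1] -/
theorem hasFDerivAt_det_apply_eq_det_mul_trace (hdet : (Matrix.of (A y)).det ≠ 0) (v : E) :
    (∑ j, ∑ i, (Matrix.of (A y)).adjugate i j •
        ((ContinuousLinearMap.proj i).comp ((ContinuousLinearMap.proj j).comp A'))) v =
      (Matrix.of (A y)).det * ((Matrix.of (A y))⁻¹ * Matrix.of (A' v)).trace := by
  rw [hasFDerivAt_det_apply_eq_trace,
    trace_mul_adjugate_eq_det_mul_trace _ _ (isUnit_iff_ne_zero.2 hdet)]

/-- The derivative of `det A` in the direction `v`, as a number: if `A` has derivative `A'` at `y`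
then `fderiv (det ∘ A) y v = tr (A' v · adj (A y))`. [cite: MagnusNeudecker2019, Ch. 8 Thm. 8.1] -/
theorem fderiv_det_apply (hA : HasFDerivAt A A' y) (v : E) :
    fderiv ℝ (fun z ↦ (Matrix.of (A z)).det) y v =
      (Matrix.of (A' v) * (Matrix.of (A y)).adjugate).trace := by
  rw [(hasFDerivAt_det hA).fderiv, hasFDerivAt_det_apply_eq_trace]

/-- **The derivative of `√(det A)`**: if `det A(y) > 0` then `z ↦ √(det A(z))` is differentiable
at `y`, with derivative `(2√(det A(y)))⁻¹` times that of `det A`. [cite: MagnusNeudecker2019, Ch. 8 Thm. 8.1] -/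
theorem hasFDerivAt_sqrt_det (hA : HasFDerivAt A A' y) (hpos : 0 < (Matrix.of (A y)).det) :
    HasFDerivAt (fun z ↦ Real.sqrt (Matrix.of (A z)).det)
      ((1 / (2 * Real.sqrt (Matrix.of (A y)).det)) •
        ∑ j, ∑ i, (Matrix.of (A y)).adjugate i j •
          ((ContinuousLinearMap.proj i).comp ((ContinuousLinearMap.proj j).comp A'))) y :=
  (hasFDerivAt_det hA).sqrt hpos.ne'

/-- **The logarithmic derivative of the volume density**: for `det A(y) > 0`,
`d(√(det A))(y)(v) = ½ √(det A(y)) · tr (A(y)⁻¹ A' v)` — the identity `∂ log √g = ½ gᵃᵇ ∂g_{ab}`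
of Riemannian geometry. [cite: MagnusNeudecker2019, Ch. 8 Thm. 8.1] -/
theorem hasFDerivAt_sqrt_det_apply (hA : HasFDerivAt A A' y) (hpos : 0 < (Matrix.of (A y)).det)
    (v : E) :
    fderiv ℝ (fun z ↦ Real.sqrt (Matrix.of (A z)).det) y v =
      2⁻¹ * Real.sqrt (Matrix.of (A y)).det * ((Matrix.of (A y))⁻¹ * Matrix.of (A' v)).trace := by
  rw [(hasFDerivAt_sqrt_det hA hpos).fderiv, _root_.smul_apply,
    hasFDerivAt_det_apply_eq_det_mul_trace hpos.ne', smul_eq_mul]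
  have key : ∀ s d T : ℝ, 0 < s → s * s = d → 1 / (2 * s) * (d * T) = 2⁻¹ * s * T := by
    intro s d T hs hsd
    subst hsd
    field_simp
  exact key _ _ _ (Real.sqrt_pos.2 hpos) (Real.mul_self_sqrt hpos.le)

/-! ### Differentiability of the cofactors and of the inverse -/

/-- Replacing one row by a constant is an affine operation: `z ↦ (A z with row l := c)` has
derivative `v ↦ (A' v with row l := 0)`. [folklore] -/
theorem hasFDerivAt_update_const (hA : HasFDerivAt A A' y) (l : ι) (c : ι → ℝ) :
    HasFDerivAt (fun z ↦ update (A z) l c)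
      (ContinuousLinearMap.pi fun j ↦
        if j = l then (0 : E →L[ℝ] (ι → ℝ)) else (ContinuousLinearMap.proj j).comp A') y := by
  have h : ∀ j, HasFDerivAt (fun z ↦ update (A z) l c j)
      (if j = l then (0 : E →L[ℝ] (ι → ℝ)) else (ContinuousLinearMap.proj j).comp A') y := by
    intro j
    by_cases hj : j = l
    · subst hj
      simp only [update_self, if_true]
      exact hasFDerivAt_const c y
    · simp only [update_of_ne hj, if_neg hj]
      exact (hasFDerivAt_pi'.1 hA) j
  exact hasFDerivAt_pi.2 h

/-- **The cofactors of a differentiable matrix field are differentiable**: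
`z ↦ adj(A z)ᵢₗ = det (A z with row l := eᵢ)`. [folklore] -/
theorem differentiableAt_adjugate_apply (hA : HasFDerivAt A A' y) (i l : ι) :
    DifferentiableAt ℝ (fun z ↦ (Matrix.of (A z)).adjugate i l) y := by
  have h := hasFDerivAt_det (hasFDerivAt_update_const hA l (Pi.single i 1))
  have heq : (fun z ↦ (Matrix.of (A z)).adjugate i l) =
      fun z ↦ (Matrix.of (update (A z) l (Pi.single i 1))).det := by
    funext z
    rw [adjugate_apply]
    rfl
  rw [heq]
  exact h.differentiableAt

/-- **The entries of the inverse of a differentiable matrix field are differentiable where the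
determinant does not vanish** (`A⁻¹ = (det A)⁻¹ • adj A`). [folklore] -/
theorem differentiableAt_inv_apply (hA : HasFDerivAt A A' y) (hdet : (Matrix.of (A y)).det ≠ 0)
    (k l : ι) : DifferentiableAt ℝ (fun z ↦ (Matrix.of (A z))⁻¹ k l) y := by
  have heq : (fun z ↦ (Matrix.of (A z))⁻¹ k l) =
      fun z ↦ ((Matrix.of (A z)).det)⁻¹ * (Matrix.of (A z)).adjugate k l := by
    funext z
    rw [Matrix.inv_def, Matrix.smul_apply, smul_eq_mul, Ring.inverse_eq_inv']
  rw [heq]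
  exact ((hasFDerivAt_det hA).differentiableAt.inv hdet).mul
    (differentiableAt_adjugate_apply hA k l)

/-- Near a point where `det A ≠ 0`, the determinant stays nonzero (continuity). [folklore] -/
theorem eventually_det_ne_zero (hA : HasFDerivAt A A' y) (hdet : (Matrix.of (A y)).det ≠ 0) :
    ∀ᶠ z in 𝓝 y, (Matrix.of (A z)).det ≠ 0 :=
  ((hasFDerivAt_det hA).continuousAt).eventually_ne hdet

/-- **The derivative of the inverse matrix**: if `A` has derivative `A'` at `y` and `det A(y) ≠ 0`,
then each entry of `z ↦ A(z)⁻¹` is differentiable at `y` with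
`d(A⁻¹)ₖₗ (v) = -∑ᵢ ∑ⱼ (A y)⁻¹ₖᵢ (A' v)ᵢⱼ (A y)⁻¹ⱼₗ`, i.e. `d(A⁻¹) = -A⁻¹ (dA) A⁻¹`
(implicit differentiation of `A A⁻¹ = 1` near `y`). Magnus–Neudecker 2019, Ch. 8, §8.4
(Thm. 8.3). [cite: MagnusNeudecker2019, Ch. 8 §8.4] -/
theorem hasFDerivAt_inv_apply (hA : HasFDerivAt A A' y) (hdet : (Matrix.of (A y)).det ≠ 0)
    (k l : ι) :
    HasFDerivAt (fun z ↦ (Matrix.of (A z))⁻¹ k l)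
      (-∑ i, ∑ j, ((Matrix.of (A y))⁻¹ k i * (Matrix.of (A y))⁻¹ j l) •
        ((ContinuousLinearMap.proj j).comp ((ContinuousLinearMap.proj i).comp A'))) y := by
  -- notation
  set M : Matrix ι ι ℝ := Matrix.of (A y) with hM
  have hMu : IsUnit M.det := isUnit_iff_ne_zero.2 hdet
  -- the entries of the inverse are differentiable; call their derivatives `D j l`
  have hD : ∀ j l, HasFDerivAt (fun z ↦ (Matrix.of (A z))⁻¹ j l)
      (fderiv ℝ (fun z ↦ (Matrix.of (A z))⁻¹ j l) y) y :=
    fun j l ↦ (differentiableAt_inv_apply hA hdet j l).hasFDerivAt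
  set D : ι → ι → (E →L[ℝ] ℝ) := fun j l ↦ fderiv ℝ (fun z ↦ (Matrix.of (A z))⁻¹ j l) y with hDdef
  -- the entries of `A` are differentiable with derivative `v ↦ A' v i j`
  have hAij : ∀ i j, HasFDerivAt (fun z ↦ A z i j)
      ((ContinuousLinearMap.proj j).comp ((ContinuousLinearMap.proj i).comp A')) y := by
    intro i j
    have h1 := (hasFDerivAt_pi'.1 hA) i
    exact (hasFDerivAt_pi'.1 h1) j
  -- implicit differentiation of `∑ⱼ A i j · (A⁻¹) j l = δ i l` near `y`
  have hF : ∀ i l, HasFDerivAt (fun z ↦ ∑ j, A z i j * (Matrix.of (A z))⁻¹ j l)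
      (∑ j, (A y i j • D j l +
        (Matrix.of (A y))⁻¹ j l • (ContinuousLinearMap.proj j).comp
          ((ContinuousLinearMap.proj i).comp A'))) y := by
    intro i l
    refine HasFDerivAt.fun_sum (fun j _ ↦ ?_)
    exact (hAij i j).mul (hD j l)
  have hF0 : ∀ i l, HasFDerivAt (fun z ↦ ∑ j, A z i j * (Matrix.of (A z))⁻¹ j l)
      (0 : E →L[ℝ] ℝ) y := by
    intro i l
    have hconst : (fun z ↦ ∑ j, A z i j * (Matrix.of (A z))⁻¹ j l) =ᶠ[𝓝 y]
        fun _ ↦ (1 : Matrix ι ι ℝ) i l := by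
      filter_upwards [eventually_det_ne_zero hA hdet] with z hz
      have h := Matrix.mul_nonsing_inv (Matrix.of (A z)) (isUnit_iff_ne_zero.2 hz)
      have h' := congr_fun (congr_fun h i) l
      rw [Matrix.mul_apply] at h'
      exact h'
    exact (hasFDerivAt_const _ y).congr_of_eventuallyEq hconst
  -- hence, for every `v`, the matrix identity `A' v · A⁻¹ + A · (D v) = 0`
  have hmat : ∀ v, Matrix.of (A' v) * M⁻¹ + M * Matrix.of (fun j l ↦ D j l v) = 0 := by
    intro v
    ext i l
    have h := congr_arg (fun L : E →L[ℝ] ℝ ↦ L v) ((hF i l).unique (hF0 i l))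
    simp only [FunLike.coe_sum, Finset.sum_apply, _root_.add_apply,
      _root_.smul_apply, ContinuousLinearMap.comp_apply,
      ContinuousLinearMap.proj_apply, smul_eq_mul, _root_.zero_apply] at h
    simp only [Matrix.add_apply, Matrix.mul_apply, Matrix.of_apply, Matrix.zero_apply, hM]
    rw [← h, ← Finset.sum_add_distrib]
    refine sum_congr rfl (fun j _ ↦ ?_)
    ring
  -- so `D v = -A⁻¹ (A' v) A⁻¹`
  have hsolve : ∀ v, Matrix.of (fun j l ↦ D j l v) = -(M⁻¹ * Matrix.of (A' v) * M⁻¹) := by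
    intro v
    have h1 : M⁻¹ * (Matrix.of (A' v) * M⁻¹ + M * Matrix.of (fun j l ↦ D j l v)) = 0 := by
      rw [hmat v, Matrix.mul_zero]
    rw [Matrix.mul_add, ← Matrix.mul_assoc, ← Matrix.mul_assoc, Matrix.nonsing_inv_mul _ hMu,
      Matrix.one_mul] at h1
    exact eq_neg_of_add_eq_zero_right h1
  -- read off the `(k, l)` entry
  refine (hD k l).congr_fderiv ?_
  ext v
  have h := congr_fun (congr_fun (hsolve v) k) l
  simp only [Matrix.of_apply, Matrix.neg_apply, Matrix.mul_apply, Finset.sum_mul] at h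
  change D k l v = _
  rw [h]
  simp only [_root_.neg_apply, FunLike.coe_sum, Finset.sum_apply, _root_.smul_apply,
    ContinuousLinearMap.comp_apply, ContinuousLinearMap.proj_apply, smul_eq_mul, hM]
  rw [Finset.sum_comm]
  congr 1
  refine sum_congr rfl (fun i _ ↦ sum_congr rfl (fun j _ ↦ ?_))
  ring

/-- The derivative of an entry of the inverse in the direction `v`, as a number:
`fderiv (A⁻¹)ₖₗ y v = -∑ᵢ ∑ⱼ (A y)⁻¹ₖᵢ (A' v)ᵢⱼ (A y)⁻¹ⱼₗ = -(A⁻¹ (A' v) A⁻¹)ₖₗ`.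
[cite: MagnusNeudecker2019, Ch. 8 §8.4] -/
theorem fderiv_inv_apply (hA : HasFDerivAt A A' y) (hdet : (Matrix.of (A y)).det ≠ 0)
    (k l : ι) (v : E) :
    fderiv ℝ (fun z ↦ (Matrix.of (A z))⁻¹ k l) y v =
      -((Matrix.of (A y))⁻¹ * Matrix.of (A' v) * (Matrix.of (A y))⁻¹) k l := by
  rw [(hasFDerivAt_inv_apply hA hdet k l).fderiv]
  simp only [_root_.neg_apply, FunLike.coe_sum, Finset.sum_apply, _root_.smul_apply,
    ContinuousLinearMap.comp_apply, ContinuousLinearMap.proj_apply, smul_eq_mul,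
    Matrix.mul_apply, Matrix.of_apply, Finset.sum_mul]
  rw [Finset.sum_comm]
  congr 1
  refine sum_congr rfl (fun i _ ↦ sum_congr rfl (fun j _ ↦ ?_))
  ring

end Literature.Analysis.Calculus

end
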